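import Summits.ResolutionOfSingularities.ResolutionOfSingularities.Theorems.FrobeniusLadderFInjectiveMacaulayficationPointFixableCentre
import HarnessLib

/-!
# Curve stage, §C2 — the FULL clause over `η` from a LOCAL FIX `LocFix(η)` and a spread `J` with `J_η = (c)`
# (crux `FInjectiveMacaulayfication` stmt-ResolutionOfSingularities-15315, chain w45a, hole #3β; U13 `CurveStageProducer`, file 2/3)

[OURS · L1 W4.5a · res-D-pv-019 AS res-L1-w45a-stub-7] Support file (`--supports stmt-ResolutionOfSingularities-15315 --as helper`)
for the crux `FrobeniusLadder.FInjectiveMacaulayfication`; NOT a statement of any manuscript; AI-written, weaker than expert review.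
Statement = §C2 `stub_full_over_of_locFix` of strat-1's `L/res-L1-w45a-strat-1/CurveStageSig.lean` (SIG OF RECORD, plan-1 R12.38;
on-disk sha16 935ed93c8e42a36f, announced as f81f934dfe54696f) VERBATIM with `stub_` dropped.

THE THEOREM (`full_over_of_locFix`). If the centre `(c) ⊆ 𝒪_{X₁,η}` fixes `η` locally — the FULL clause (domain ∧ Cohen–Macaulay
∧ Frobenius-closed parameter ideals) holds at every prime of every chart `𝒪_η[(c)/c_j]` lying over `𝔪_η` — and `J` is an ideal
sheaf with `J_η = (c)`, then every blowing up `π : X₂ ⟶ X₁` along `J` satisfies the FULL clause at every point over `η`.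
PROOF = the last lines of `PointFixableCentre.pointFixable_h4` at a general point: the dictionary
`IsBlowup.exists_blowupAlgebra_stalk_ringEquiv_of_eq` (Stacks 0804) presents `𝒪_{X₂,x} ≅ (𝒪_η[(c)/c_j])_𝔔` with `𝔔` over `𝔪_η`,
and the clause moves along the ring isomorphism (`MulEquiv.isDomain`, `DegreeZeroDescent.inlineClause_of_ringEquiv`). No named facts.
-/

-- single-problem summit: the doubled namespace component is forced
set_option linter.dupNamespace false

noncomputable section

open AlgebraicGeometry CategoryTheory Literature.AlgebraicGeometry.Resolution TopologicalSpace IsLocalRing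

namespace Summit.ResolutionOfSingularities.ResolutionOfSingularities.Theorems.FInjectiveMacaulayfication.CurveStageFull

open Summit.ResolutionOfSingularities.ResolutionOfSingularities.Theorems.FInjectiveMacaulayfication

/-- **§C2 — FULL clause over `η` from a local fix** (`CurveStageSig` §C2 `stub_full_over_of_locFix`, verbatim): for `x` over
`η`, `𝒪_{X₂,x} ≅ (𝒪_η[(c)/c_j])_𝔔` with `𝔔 ∩ 𝒪_η = 𝔪_η` (Stacks 0804 dictionary), where `LocFix(η)` gives the clause; transport
along the isomorphism. [folklore] -/
theorem full_over_of_locFix : ∀ (p : ℕ) (X₁ : Scheme.{0}) (η : X₁) (n : ℕ) (c : Fin n → X₁.presheaf.stalk η),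
    (∀ (j : Fin n) (𝔔 : PrimeSpectrum (blowupAlgebra (Ideal.span (Set.range c)) (c j))),
      𝔔.asIdeal.comap (algebraMap (X₁.presheaf.stalk η) (blowupAlgebra (Ideal.span (Set.range c)) (c j))) =
        maximalIdeal (X₁.presheaf.stalk η) →
      IsDomain (Localization.AtPrime 𝔔.asIdeal) ∧ ∀ d : ℕ, ringKrullDim (Localization.AtPrime 𝔔.asIdeal) = d →
        ∀ s : Fin d → Localization.AtPrime 𝔔.asIdeal, (Ideal.span (Set.range s)).radical.IsMaximal →
          RingTheory.Sequence.IsWeaklyRegular (Localization.AtPrime 𝔔.asIdeal) (List.ofFn s) ∧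
          ∀ y : Localization.AtPrime 𝔔.asIdeal, (∃ e : ℕ, y ^ p ^ e ∈ Ideal.span ((fun z : Localization.AtPrime 𝔔.asIdeal => z ^ p ^ e) ''
            (Ideal.span (Set.range s) : Set (Localization.AtPrime 𝔔.asIdeal)))) → y ∈ Ideal.span (Set.range s)) →
    ∀ (J : X₁.IdealSheafData), stalkIdeal J η = Ideal.span (Set.range c) →
    ∀ (X₂ : Scheme.{0}) (π : X₂ ⟶ X₁), IsBlowup π J → ∀ x : X₂, π.base x = η →
      IsDomain (X₂.presheaf.stalk x) ∧ ∀ d : ℕ, ringKrullDim (X₂.presheaf.stalk x) = d → ∀ s : Fin d → X₂.presheaf.stalk x,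
        (Ideal.span (Set.range s)).radical.IsMaximal → RingTheory.Sequence.IsWeaklyRegular (X₂.presheaf.stalk x) (List.ofFn s) ∧
        ∀ t : X₂.presheaf.stalk x, (∃ e : ℕ, t ^ p ^ e ∈ Ideal.span ((fun z : X₂.presheaf.stalk x => z ^ p ^ e) ''
          (Ideal.span (Set.range s) : Set (X₂.presheaf.stalk x)))) → t ∈ Ideal.span (Set.range s)  := by
  intro p X₁ η n c hgood J hJ X₂ π hπ x hx
  subst hx
  obtain ⟨j, 𝔔, -, e, -, -, -, h𝔔⟩ :=
    hπ.exists_blowupAlgebra_stalk_ringEquiv_of_eq x c (Ideal.span (Set.range c)) rfl hJ.symm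
  obtain ⟨hdom, hq⟩ := hgood j 𝔔 h𝔔
  haveI := hdom
  exact ⟨MulEquiv.isDomain (Localization.AtPrime 𝔔.asIdeal) e.toMulEquiv,
    DegreeZeroDescent.inlineClause_of_ringEquiv p (L := Localization.AtPrime 𝔔.asIdeal) (L' := X₂.presheaf.stalk x) e.symm hq⟩

end Summit.ResolutionOfSingularities.ResolutionOfSingularities.Theorems.FInjectiveMacaulayfication.CurveStageFull

end
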